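import Summits.Ventures.HodgeRepro2.T5InertCongruenceSubgroup

/-!
# The congruence filtration of the unipotent radical at an inert place, part 1: the subgroups `N_{a,b}`
(cell pub-hodge-repro2, seat p3)

Tier-5 N3 support, towards the one count the Satake chain of files 186–194 still owes to print
(T5-SATAKE-KERNEL-p3.md row 11): `deg Tₙ = [K : K ∩ aₙ K aₙ⁻¹] = (q³ + 1) q^{4n−3}`. The index is computed
through the UPPER UNIPOTENT RADICAL `N = {n(x, z)}` of `U(antidiag(1, u, 1))` (p8's `upper3 u x z`), filtered
by the congruence conditions `x ∈ ϖ^a R`, `z ∈ ϖ^b R`. This file: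

* `upper3_mul` — `n(x, z) · n(x', z') = n(x + x', z + z' − x x̄'/u)` (the Heisenberg law), `upper3_inj`;
* **`unipCong a b`** — the subgroup `N_{a,b} = {n(ϖ^a x, ϖ^b z) : x, z ∈ R}` of `U(J₃(u))` (a subgroup when
  `b ≤ 2a`: `upper3_cong_mul`, `upper3_cong_inv`), with unique `R`-coordinates `xcoord`, `zcoord`
  (`coe_eq_upper3`, `coord_eq_of_coe_eq`), `xcoord_mul` additive, `zcoord_mul` additive modulo `ϖ^{2a−b}`;
* `exists_mem_unipCong_coe_eq` — every `x ∈ R` is a first coordinate (the trace lift `e + ē = 1` supplies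
  `z = −e ϖ^{2a−b} x̄ x u⁻¹`), and `zcoord_add_star_eq` — the unitary relation `z + z̄ = −ϖ^{2a−b} x̄ x / u`.

File 196 (`T5InertUnipotentResidue`) reads the coordinates modulo `ϖ` and computes the indices
`[N_{a,b} : N_{a+1,b}] = #𝔽` and `[N_{a,b} : N_{a,b+1}] = #{t ∈ 𝔽 : t + t̄ = 0}`.

Mathlib + this seat's file 193 and its imports (p8's T5-134 / T5-136 / T5-143 / degree index); no display;
no device. §8(d): uses an L-value-free non-vanishing device: NO.
-/

namespace Summit.Ventures.HodgeRepro2.T5InertUnipotentCongruence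

open Matrix
open Summit.Ventures.HodgeRepro2.T5CartanCellsDistinct Summit.Ventures.HodgeRepro2.T5HermitianThreeElements
  Summit.Ventures.HodgeRepro2.T5UnitaryGroupForm Summit.Ventures.HodgeRepro2.T5UnitaryThreeCorner
  Summit.Ventures.HodgeRepro2.T5UnitaryHeckeAdjoint

/-! ## The upper unipotent elements `n(x, z)` -/

section Upper3

variable {E : Type*} [Field E] [StarRing E] (u : E)

/-- `n(0, 0) = 1`. -/
theorem upper3_zero_zero : upper3 u 0 0 = 1 := by
  ext1
  rw [coe_upper3, Units.val_one]
  simp [Matrix.one_fin_three]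

/-- **The product of two upper unipotents**: `n(x, z) · n(x', z') = n(x + x', z + z' − x x̄'/u)`. -/
theorem upper3_mul (x z x' z' : E) :
    upper3 u x z * upper3 u x' z' = upper3 u (x + x') (z + z' - x * star x' / u) := by
  ext1
  rw [Units.val_mul, coe_upper3, coe_upper3, coe_upper3, Matrix.mul_fin_three, fin_three_eq_iff]
  refine ⟨by ring, by ring, by ring, by ring, by ring, ?_, by ring, by ring, by ring⟩
  rw [star_add]
  ring

/-- The coordinates of `n(x, z)` are read off the entries `(0, 1)` and `(0, 2)`. -/
theorem upper3_inj {x z x' z' : E} (h : upper3 u x z = upper3 u x' z') : x = x' ∧ z = z' := by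
  have h' := congrArg Units.val h
  rw [coe_upper3, coe_upper3, fin_three_eq_iff] at h'
  exact ⟨h'.2.1, h'.2.2.1⟩

end Upper3

/-! ## The congruence subgroups `N_{a,b}` of the unipotent radical -/

section Unipotent

variable {R E : Type*} [CommRing R] [Field E] [StarRing E] [Algebra R E] [IsFractionRing R E]
  (hstar : ∀ x : E, IsLocalization.IsInteger R x → IsLocalization.IsInteger R (star x))
  (u : E) (hu' : IsLocalization.IsInteger R u⁻¹)
  {ϖ : R} (hs : star (algebraMap R E ϖ) = algebraMap R E ϖ)

omit [IsFractionRing R E] in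
include hs in
/-- The product of two congruence unipotents, in `R`-coordinates. -/
theorem upper3_cong_mul {a b : ℕ} (hab : b ≤ 2 * a) (x z x' z' xs u' : R)
    (hxs : algebraMap R E xs = star (algebraMap R E x')) (hu'' : algebraMap R E u' = u⁻¹) :
    upper3 u (algebraMap R E ϖ ^ a * algebraMap R E x) (algebraMap R E ϖ ^ b * algebraMap R E z) *
        upper3 u (algebraMap R E ϖ ^ a * algebraMap R E x') (algebraMap R E ϖ ^ b * algebraMap R E z') =
      upper3 u (algebraMap R E ϖ ^ a * algebraMap R E (x + x'))
        (algebraMap R E ϖ ^ b * algebraMap R E (z + z' - ϖ ^ (2 * a - b) * x * xs * u')) := by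
  rw [upper3_mul]
  have h2a : algebraMap R E ϖ ^ b * algebraMap R E ϖ ^ (2 * a - b) =
      algebraMap R E ϖ ^ a * algebraMap R E ϖ ^ a := by
    rw [← pow_add, Nat.add_sub_cancel' hab, two_mul, pow_add]
  congr 1
  · rw [map_add, mul_add]
  · rw [star_mul, star_pow, hs, ← hxs, div_eq_mul_inv, ← hu'']
    simp only [map_sub, map_add, map_mul, map_pow]
    linear_combination (algebraMap R E x * algebraMap R E xs * algebraMap R E u') * h2a

omit [IsFractionRing R E] in
include hs in
/-- The inverse of a congruence unipotent, in `R`-coordinates. -/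
theorem upper3_cong_inv {a b : ℕ} (hab : b ≤ 2 * a) (x z xs u' : R)
    (hxs : algebraMap R E xs = star (algebraMap R E x)) (hu'' : algebraMap R E u' = u⁻¹) :
    (upper3 u (algebraMap R E ϖ ^ a * algebraMap R E x) (algebraMap R E ϖ ^ b * algebraMap R E z))⁻¹ =
      upper3 u (algebraMap R E ϖ ^ a * algebraMap R E (-x))
        (algebraMap R E ϖ ^ b * algebraMap R E (-(ϖ ^ (2 * a - b) * x * xs * u') - z)) := by
  rw [upper3_inv]
  have h2a : algebraMap R E ϖ ^ b * algebraMap R E ϖ ^ (2 * a - b) =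
      algebraMap R E ϖ ^ a * algebraMap R E ϖ ^ a := by
    rw [← pow_add, Nat.add_sub_cancel' hab, two_mul, pow_add]
  congr 1
  · rw [map_neg, mul_neg]
  · rw [star_mul, star_pow, hs, ← hxs, neg_div, mul_neg, div_eq_mul_inv, ← hu'']
    simp only [map_sub, map_neg, map_mul, map_pow]
    linear_combination (algebraMap R E x * algebraMap R E xs * algebraMap R E u') * h2a

/-- **`N_{a,b} = {n(ϖ^a x, ϖ^b z) : x, z ∈ R}`**, the congruence subgroup of the upper unipotent radical
of `U(antidiag(1, u, 1))` (a subgroup when `b ≤ 2a`). -/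
def unipCong (a b : ℕ) (hab : b ≤ 2 * a) : Subgroup (formUnitaryGroup (J3 u)) where
  carrier := {g | ∃ x z : R, (g : GL (Fin 3) E) =
    upper3 u (algebraMap R E ϖ ^ a * algebraMap R E x) (algebraMap R E ϖ ^ b * algebraMap R E z)}
  one_mem' := ⟨0, 0, by
    rw [OneMemClass.coe_one, map_zero, mul_zero, mul_zero, upper3_zero_zero]⟩
  mul_mem' := by
    rintro g g' ⟨x, z, hg⟩ ⟨x', z', hg'⟩
    obtain ⟨xs, hxs⟩ := hstar _ ⟨x', rfl⟩
    obtain ⟨u', hu''⟩ := id hu'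
    exact ⟨x + x', z + z' - ϖ ^ (2 * a - b) * x * xs * u', by
      rw [Subgroup.coe_mul, hg, hg', upper3_cong_mul u hs hab x z x' z' xs u' hxs hu'']⟩
  inv_mem' := by
    rintro g ⟨x, z, hg⟩
    obtain ⟨xs, hxs⟩ := hstar _ ⟨x, rfl⟩
    obtain ⟨u', hu''⟩ := id hu'
    exact ⟨-x, -(ϖ ^ (2 * a - b) * x * xs * u') - z, by
      rw [Subgroup.coe_inv, hg, upper3_cong_inv u hs hab x z xs u' hxs hu'']⟩

variable {a b : ℕ} {hab : b ≤ 2 * a}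

omit [IsFractionRing R E] in
/-- Membership in `N_{a,b}`: `g = n(ϖ^a x, ϖ^b z)` for some `x, z ∈ R`. -/
theorem mem_unipCong_iff {g : formUnitaryGroup (J3 u)} :
    g ∈ unipCong hstar u hu' hs a b hab ↔ ∃ x z : R, (g : GL (Fin 3) E) =
      upper3 u (algebraMap R E ϖ ^ a * algebraMap R E x) (algebraMap R E ϖ ^ b * algebraMap R E z) :=
  Iff.rfl

variable (hϖ : Irreducible ϖ)

include hϖ in
/-- The `R`-coordinates of a congruence unipotent are unique. -/
theorem eq_of_upper3_cong_eq {x z x' z' : R}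
    (h : upper3 u (algebraMap R E ϖ ^ a * algebraMap R E x) (algebraMap R E ϖ ^ b * algebraMap R E z) =
      upper3 u (algebraMap R E ϖ ^ a * algebraMap R E x') (algebraMap R E ϖ ^ b * algebraMap R E z')) :
    x = x' ∧ z = z' := by
  obtain ⟨h1, h2⟩ := upper3_inj u h
  have hπ0 : algebraMap R E ϖ ≠ 0 :=
    (map_ne_zero_iff _ (IsFractionRing.injective R E)).2 hϖ.ne_zero
  exact ⟨IsFractionRing.injective R E (mul_left_cancel₀ (pow_ne_zero _ hπ0) h1),
    IsFractionRing.injective R E (mul_left_cancel₀ (pow_ne_zero _ hπ0) h2)⟩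

/-- The `x`-coordinate of an element of `N_{a,b}`: `n(ϖ^a x, ϖ^b z) ↦ x`. -/
noncomputable def xcoord (g : unipCong hstar u hu' hs a b hab) : R := Classical.choose g.2

/-- The `z`-coordinate of an element of `N_{a,b}`: `n(ϖ^a x, ϖ^b z) ↦ z`. -/
noncomputable def zcoord (g : unipCong hstar u hu' hs a b hab) : R :=
  Classical.choose (Classical.choose_spec g.2)

omit [IsFractionRing R E] in
/-- Every element of `N_{a,b}` is `n(ϖ^a x, ϖ^b z)` for its coordinates `x = xcoord g`, `z = zcoord g`. -/
theorem coe_eq_upper3 (g : unipCong hstar u hu' hs a b hab) :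
    ((g : formUnitaryGroup (J3 u)) : GL (Fin 3) E) =
      upper3 u (algebraMap R E ϖ ^ a * algebraMap R E (xcoord hstar u hu' hs g))
        (algebraMap R E ϖ ^ b * algebraMap R E (zcoord hstar u hu' hs g)) :=
  Classical.choose_spec (Classical.choose_spec g.2)

include hϖ in
/-- The coordinates are determined by any presentation `g = n(ϖ^a x, ϖ^b z)`. -/
theorem coord_eq_of_coe_eq {g : unipCong hstar u hu' hs a b hab} {x z : R}
    (h : ((g : formUnitaryGroup (J3 u)) : GL (Fin 3) E) =
      upper3 u (algebraMap R E ϖ ^ a * algebraMap R E x) (algebraMap R E ϖ ^ b * algebraMap R E z)) :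
    xcoord hstar u hu' hs g = x ∧ zcoord hstar u hu' hs g = z :=
  eq_of_upper3_cong_eq u hϖ ((coe_eq_upper3 hstar u hu' hs g).symm.trans h)

include hϖ in
/-- The `x`-coordinate of `1` is `0`. -/
theorem xcoord_one : xcoord hstar u hu' hs (1 : unipCong hstar u hu' hs a b hab) = 0 :=
  (coord_eq_of_coe_eq hstar u hu' hs hϖ (by
    rw [OneMemClass.coe_one, OneMemClass.coe_one, map_zero, mul_zero, mul_zero,
      upper3_zero_zero])).1

include hϖ in
/-- The `z`-coordinate of `1` is `0`. -/
theorem zcoord_one : zcoord hstar u hu' hs (1 : unipCong hstar u hu' hs a b hab) = 0 :=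
  (coord_eq_of_coe_eq hstar u hu' hs hϖ (by
    rw [OneMemClass.coe_one, OneMemClass.coe_one, map_zero, mul_zero, mul_zero,
      upper3_zero_zero])).2

include hϖ in
/-- The `x`-coordinate is additive. -/
theorem xcoord_mul (g g' : unipCong hstar u hu' hs a b hab) :
    xcoord hstar u hu' hs (g * g') = xcoord hstar u hu' hs g + xcoord hstar u hu' hs g' := by
  obtain ⟨xs, hxs⟩ := hstar _ ⟨xcoord hstar u hu' hs g', rfl⟩
  obtain ⟨u', hu''⟩ := id hu'
  exact (coord_eq_of_coe_eq hstar u hu' hs hϖ (g := g * g')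
    (x := xcoord hstar u hu' hs g + xcoord hstar u hu' hs g')
    (z := zcoord hstar u hu' hs g + zcoord hstar u hu' hs g' -
      ϖ ^ (2 * a - b) * xcoord hstar u hu' hs g * xs * u') (by
    rw [Subgroup.coe_mul, Subgroup.coe_mul, coe_eq_upper3 hstar u hu' hs g,
      coe_eq_upper3 hstar u hu' hs g', upper3_cong_mul u hs hab _ _ _ _ xs u' hxs hu''])).1

include hϖ in
/-- The `z`-coordinate is additive up to a multiple of `ϖ^{2a−b}`. -/
theorem zcoord_mul (g g' : unipCong hstar u hu' hs a b hab) :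
    ∃ w : R, zcoord hstar u hu' hs (g * g') =
      zcoord hstar u hu' hs g + zcoord hstar u hu' hs g' - ϖ ^ (2 * a - b) * w := by
  obtain ⟨xs, hxs⟩ := hstar _ ⟨xcoord hstar u hu' hs g', rfl⟩
  obtain ⟨u', hu''⟩ := id hu'
  refine ⟨xcoord hstar u hu' hs g * xs * u', ?_⟩
  have := (coord_eq_of_coe_eq hstar u hu' hs hϖ (g := g * g')
    (x := xcoord hstar u hu' hs g + xcoord hstar u hu' hs g')
    (z := zcoord hstar u hu' hs g + zcoord hstar u hu' hs g' -
      ϖ ^ (2 * a - b) * xcoord hstar u hu' hs g * xs * u') (by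
    rw [Subgroup.coe_mul, Subgroup.coe_mul, coe_eq_upper3 hstar u hu' hs g,
      coe_eq_upper3 hstar u hu' hs g', upper3_cong_mul u hs hab _ _ _ _ xs u' hxs hu''])).2
  rw [this]
  ring

variable (hsu : star u = u) (hu0 : u ≠ 0)

omit [IsFractionRing R E] in
include hsu hu0 in
/-- Every `x ∈ R` is the first coordinate of an element of `N_{a,b}`: the trace lift `e` (`e + ē = 1`)
supplies the second coordinate `z = −e ϖ^{2a−b} x̄ x u⁻¹`. -/
theorem exists_mem_unipCong_coe_eq (htr : ∃ e : R, algebraMap R E e + star (algebraMap R E e) = 1)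
    (x : R) :
    ∃ g ∈ unipCong hstar u hu' hs a b hab, ∃ z : R, (g : GL (Fin 3) E) =
      upper3 u (algebraMap R E ϖ ^ a * algebraMap R E x) (algebraMap R E ϖ ^ b * algebraMap R E z) := by
  obtain ⟨e, he⟩ := htr
  obtain ⟨xs, hxs⟩ := hstar _ ⟨x, rfl⟩
  obtain ⟨u', hu''⟩ := id hu'
  have h2a : algebraMap R E ϖ ^ b * algebraMap R E ϖ ^ (2 * a - b) =
      algebraMap R E ϖ ^ a * algebraMap R E ϖ ^ a := by
    rw [← pow_add, Nat.add_sub_cancel' hab, two_mul, pow_add]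
  have hxs' : star (algebraMap R E xs) = algebraMap R E x := by rw [hxs, star_star]
  refine ⟨⟨upper3 u (algebraMap R E ϖ ^ a * algebraMap R E x)
    (algebraMap R E ϖ ^ b * algebraMap R E (-(e * ϖ ^ (2 * a - b) * xs * x * u'))), ?_⟩,
    ⟨x, -(e * ϖ ^ (2 * a - b) * xs * x * u'), rfl⟩, -(e * ϖ ^ (2 * a - b) * xs * x * u'), rfl⟩
  apply upper3_mem u hsu hu0
  simp only [map_neg, map_mul, map_pow, star_mul, star_pow, star_neg, hs, ← hxs, hxs', hu'',
    star_inv₀, hsu]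
  rw [div_eq_mul_inv]
  linear_combination (-(algebraMap R E ϖ ^ b * algebraMap R E ϖ ^ (2 * a - b) * algebraMap R E xs *
    algebraMap R E x * u⁻¹)) * he - (algebraMap R E xs * algebraMap R E x * u⁻¹) * h2a

include hsu hu0 hϖ in
/-- The unitary relation of an element of `N_{a,b}`: `z + z̄ = −ϖ^{2a−b} x̄ x / u` in `E`. -/
theorem zcoord_add_star_eq (g : unipCong hstar u hu' hs a b hab) :
    algebraMap R E (zcoord hstar u hu' hs g) + star (algebraMap R E (zcoord hstar u hu' hs g)) =
      -(algebraMap R E ϖ ^ (2 * a - b) * star (algebraMap R E (xcoord hstar u hu' hs g)) *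
        algebraMap R E (xcoord hstar u hu' hs g) / u) := by
  have hmem := (g : formUnitaryGroup (J3 u)).2
  rw [mem_iff_fin_three u _ 1 (algebraMap R E ϖ ^ a * algebraMap R E (xcoord hstar u hu' hs g))
    (algebraMap R E ϖ ^ b * algebraMap R E (zcoord hstar u hu' hs g)) 0 1
    (-star (algebraMap R E ϖ ^ a * algebraMap R E (xcoord hstar u hu' hs g)) / u) 0 0 1
    (by rw [coe_eq_upper3 hstar u hu' hs g, coe_upper3])] at hmem
  have h22 := hmem.2.2.2.2.2.2.2.2
  have hπ0 : algebraMap R E ϖ ≠ 0 :=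
    (map_ne_zero_iff _ (IsFractionRing.injective R E)).2 hϖ.ne_zero
  have h2a : algebraMap R E ϖ ^ b * algebraMap R E ϖ ^ (2 * a - b) =
      algebraMap R E ϖ ^ a * algebraMap R E ϖ ^ a := by
    rw [← pow_add, Nat.add_sub_cancel' hab, two_mul, pow_add]
  have hsu' : ∀ X : E, star (-star X / u) = -X / u := fun X => by
    rw [star_div₀, star_neg, star_star, hsu]
  have hprod : ∀ X : E, (-X / u) * u * (-star X / u) = star X * X / u := fun X => by
    rw [div_mul_cancel₀ _ hu0]
    ring
  rw [hsu', star_one, one_mul, mul_one, hprod, star_mul, star_mul, star_pow, star_pow, hs] at h22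
  apply mul_left_cancel₀ (pow_ne_zero b hπ0)
  linear_combination h22 + (star (algebraMap R E (xcoord hstar u hu' hs g)) *
    algebraMap R E (xcoord hstar u hu' hs g) / u) * h2a

end Unipotent

end Summit.Ventures.HodgeRepro2.T5InertUnipotentCongruence
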